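import Literature.Computability.AlgebraicComplexity.BigCoppersmithWinogradProofs
import Mathlib.Tactic.DeriveFintype
import Mathlib.Data.Fintype.Sum
import HarnessLib

/-!
# The twin Coppersmith–Winograd tensor `TW_b` and its border rank `bR(TW_b) ≤ 2b + 3`

Decomposition cell `decomp-mm`, lens 1 (grading / quantitative ladder), generation 8; support for route
`SaturationLadder`, crux `SubexpSaturation` (stmt-MatrixMultiplication-25909).

`TW_b` is the structure tensor of the local algebra
`TW_b = ℂ[x'_1, …, x'_b, x''_1, …, x''_b]/(x'x'', x'_k x'_l (k ≠ l), x''_k x''_l (k ≠ l), x'_k² − x'_1², x''_k² − x''_1²)`,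
the fibre product `CW_b ×_ℂ CW_b` of two Coppersmith–Winograd algebras (Hilbert function `(1, 2b, 2)`,
dimension `2b + 3`), in its monomial basis `1, x'_i, x''_i, s₁ = x'_1², s₂ = x''_1²`:

  `TW_b = x₀y₀z₀ + Σ_i (x₀y'_i z'_i + x'_i y₀ z'_i + x₀y''_i z''_i + x''_i y₀ z''_i)`
        `+ (x₀ y_{s₁} + x_{s₁} y₀) z_{s₁} + (x₀ y_{s₂} + x_{s₂} y₀) z_{s₂} + Σ_i x'_i y'_i z_{s₁} + Σ_i x''_i y''_i z_{s₂}`.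

## Main result (proved, 0 sorry)

Coppersmith–Winograd's `q + 2`-term identity (CW 1990 §7 (10); tree: `isApproxDecomposition_bigCwTensor`)
run twice with a SHARED origin term gives an order-`3` approximate decomposition of `TW_b` with
`(b + 1) + (b + 1) + 1 = 2b + 3 = dim TW_b` triads over `K[ε]`, every commutative ring `K`:

  `Σ_k ε(x₀ + εx'_k)(y₀ + εy'_k)(z_{s₁} + εz'_k) − (x₀ + ε²Σ_k x'_k − ε³x_{s₁})(y₀ + ε²Σ_k y'_k − ε³y_{s₁})(z_{s₁} + ε²Σ_k z'_k)`
  `+ [the same with '', s₂] + x₀ y₀ ((1 − bε)(z_{s₁} + z_{s₂}) + ε³ z₀) = ε³ TW_b + O(ε⁴)`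

(`isApproxDecomposition_twTensor`), hence **`bR(TW_b) ≤ 2b + 3`** (`algBorderRank_twTensor_le`) and
`R̃(TW_b) ≤ 2b + 3` (`asymptoticRank_twTensor_le`).  Geometrically: `Spec TW_b` is the wedge of two
`Spec CW_b`, a flat limit of `(b+2) + (b+2) − 1` points; smoothability of all `(1, n, 2)` algebras is
Cartwright–Erman–Velasco–Viray 2009, Prop. 4.13, and minimal border rank of smoothable algebras'
structure tensors is Bläser–Lysikov 2016 — neither is used: the decomposition is explicit.

Indices: the inductive type `TwIdx b` (`unit`, `fst i`, `snd i`, `soc₁`, `soc₂`); the `Fin (b + b + 3)`-indexed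
copy `twTensorFin` is obtained through the equivalence `twIdxEquiv`.
-/

set_option linter.dupNamespace false

namespace Summit.MatrixMultiplication.MatrixMultiplication.Theorems.SaturationLadderTwinCW

open Polynomial Finset
open scoped BigOperators
open Literature.Computability.AlgebraicComplexity

universe u

/-! ## Indices -/

/-- The monomial basis of `TW_b`: `unit = 1`, `fst i = x'_i`, `snd i = x''_i`, `soc₁ = s₁`, `soc₂ = s₂`. [folklore] -/
inductive TwIdx (b : ℕ) : Type
  | unit : TwIdx b
  | fst : Fin b → TwIdx b
  | snd : Fin b → TwIdx b
  | soc₁ : TwIdx b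
  | soc₂ : TwIdx b
  deriving DecidableEq, Fintype

namespace TwIdx

variable {b : ℕ}

/-- `TwIdx b ≃ ((Fin b ⊕ Fin b) ⊕ Fin 3)`-style splitting used for sums: as a sum type. [folklore] -/
def equivSum : TwIdx b ≃ (Unit ⊕ Unit ⊕ Unit) ⊕ (Fin b ⊕ Fin b) where
  toFun
    | unit => Sum.inl (Sum.inl ())
    | soc₁ => Sum.inl (Sum.inr (Sum.inl ()))
    | soc₂ => Sum.inl (Sum.inr (Sum.inr ()))
    | fst i => Sum.inr (Sum.inl i)
    | snd i => Sum.inr (Sum.inr i)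
  invFun
    | Sum.inl (Sum.inl ()) => unit
    | Sum.inl (Sum.inr (Sum.inl ())) => soc₁
    | Sum.inl (Sum.inr (Sum.inr ())) => soc₂
    | Sum.inr (Sum.inl i) => fst i
    | Sum.inr (Sum.inr i) => snd i
  left_inv x := by cases x <;> rfl
  right_inv y := by rcases y with ((⟨⟩ | ⟨⟩ | ⟨⟩)) | (i | i) <;> rfl

/-- `equivSum.symm` on the first summand. [folklore] -/
@[simp] theorem equivSum_symm_inl_inl (u : Unit) : (equivSum (b := b)).symm (Sum.inl (Sum.inl u)) = unit := by
  cases u; rfl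
/-- `equivSum.symm` on the second summand. [folklore] -/
@[simp] theorem equivSum_symm_inl_inr_inl (u : Unit) :
    (equivSum (b := b)).symm (Sum.inl (Sum.inr (Sum.inl u))) = soc₁ := by
  cases u; rfl
/-- `equivSum.symm` on the third summand. [folklore] -/
@[simp] theorem equivSum_symm_inl_inr_inr (u : Unit) :
    (equivSum (b := b)).symm (Sum.inl (Sum.inr (Sum.inr u))) = soc₂ := by
  cases u; rfl
/-- `equivSum.symm` on the `x'` block. [folklore] -/
@[simp] theorem equivSum_symm_inr_inl (i : Fin b) : (equivSum (b := b)).symm (Sum.inr (Sum.inl i)) = fst i := rfl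
/-- `equivSum.symm` on the `x''` block. [folklore] -/
@[simp] theorem equivSum_symm_inr_inr (i : Fin b) : (equivSum (b := b)).symm (Sum.inr (Sum.inr i)) = snd i := rfl

/-- `Σ_ρ f ρ = f unit + f soc₁ + f soc₂ + Σ_i f (fst i) + Σ_i f (snd i)`. [folklore] -/
theorem sum_univ {M : Type*} [AddCommMonoid M] (f : TwIdx b → M) :
    ∑ ρ, f ρ = f unit + f soc₁ + f soc₂ + ∑ i : Fin b, f (fst i) + ∑ i : Fin b, f (snd i) := by
  rw [← equivSum.symm.sum_comp]
  simp only [Fintype.sum_sum_type, Fintype.sum_unique, equivSum_symm_inl_inl, equivSum_symm_inl_inr_inl,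
    equivSum_symm_inl_inr_inr, equivSum_symm_inr_inl, equivSum_symm_inr_inr, add_assoc]

/-- `card (TwIdx b) = 2b + 3`. [folklore] -/
theorem card : Fintype.card (TwIdx b) = b + b + 3 := by
  rw [Fintype.card_congr equivSum]
  simp only [Fintype.card_sum, Fintype.card_unit, Fintype.card_fin]
  omega

end TwIdx

open TwIdx

/-! ## The tensor -/

variable (K : Type u)

section Tensor

variable [CommSemiring K] {b : ℕ}

/-- Multiplication table of the monomial basis of `TW_b`: `some c` if the product of the basis elements
`a · b` is the basis element `c`, `none` if it is `0`. [folklore] -/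
def twMul : TwIdx b → TwIdx b → Option (TwIdx b)
  | unit, y => some y
  | x, unit => some x
  | fst i, fst j => if i = j then some soc₁ else none
  | snd i, snd j => if i = j then some soc₂ else none
  | _, _ => none

/-- **The twin Coppersmith–Winograd tensor** `TW_b`, the structure tensor of `TW_b = CW_b ×_K CW_b` in its
monomial basis: entry `1` at `(a, b, a·b)` when `a·b ≠ 0`, else `0`. [folklore] -/
def twTensor (b : ℕ) : TwIdx b → TwIdx b → TwIdx b → K :=
  fun x y z => if twMul x y = some z then 1 else 0

end Tensor

/-! ## The `2b + 3` approximate triads -/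

section Decomposition

variable [CommRing K] (b : ℕ)

/-- First vectors `u_ρ ∈ K[ε]^{TwIdx b}` (triads indexed by `TwIdx b` itself: `ρ = fst k`/`snd k` the small
terms, `ρ = soc₁`/`soc₂` the two big terms, `ρ = unit` the shared origin term). [folklore] -/
noncomputable def twU : TwIdx b → TwIdx b → K[X]
  | unit, unit => 1
  | unit, _ => 0
  | fst _, unit => monomial 1 1
  | fst k, fst i => if i = k then monomial 2 1 else 0
  | fst _, _ => 0
  | snd _, unit => monomial 1 1
  | snd k, snd i => if i = k then monomial 2 1 else 0
  | snd _, _ => 0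
  | soc₁, unit => -1
  | soc₁, fst _ => -monomial 2 1
  | soc₁, soc₁ => monomial 3 1
  | soc₁, _ => 0
  | soc₂, unit => -1
  | soc₂, snd _ => -monomial 2 1
  | soc₂, soc₂ => monomial 3 1
  | soc₂, _ => 0

/-- Second vectors `v_ρ`. [folklore] -/
noncomputable def twV : TwIdx b → TwIdx b → K[X]
  | unit, unit => 1
  | unit, _ => 0
  | fst _, unit => 1
  | fst k, fst i => if i = k then monomial 1 1 else 0
  | fst _, _ => 0
  | snd _, unit => 1
  | snd k, snd i => if i = k then monomial 1 1 else 0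
  | snd _, _ => 0
  | soc₁, unit => 1
  | soc₁, fst _ => monomial 2 1
  | soc₁, soc₁ => -monomial 3 1
  | soc₁, _ => 0
  | soc₂, unit => 1
  | soc₂, snd _ => monomial 2 1
  | soc₂, soc₂ => -monomial 3 1
  | soc₂, _ => 0

/-- Third vectors `w_ρ` (outputs). [folklore] -/
noncomputable def twW : TwIdx b → TwIdx b → K[X]
  | unit, unit => monomial 3 1
  | unit, soc₁ => 1 - monomial 1 (b : K)
  | unit, soc₂ => 1 - monomial 1 (b : K)
  | unit, _ => 0
  | fst _, soc₁ => 1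
  | fst k, fst i => if i = k then monomial 1 1 else 0
  | fst _, _ => 0
  | snd _, soc₂ => 1
  | snd k, snd i => if i = k then monomial 1 1 else 0
  | snd _, _ => 0
  | soc₁, soc₁ => 1
  | soc₁, fst _ => monomial 2 1
  | soc₁, _ => 0
  | soc₂, soc₂ => 1
  | soc₂, snd _ => monomial 2 1
  | soc₂, _ => 0

set_option maxHeartbeats 1000000 in
/-- **The twin identity**: `Σ_ρ u_ρ ⊗ v_ρ ⊗ w_ρ = ε³ TW_b + O(ε⁴)` with the `2b + 3` triads indexed by
`TwIdx b` (order-`3` condition of Bläser 2013, Def. 6.1, coefficientwise; `5³` index cases × `4` degrees,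
each closed by `simp`). [folklore] -/
theorem twIdentity (x y z : TwIdx b) (j : ℕ) (hj : j ≤ 3) :
    (∑ ρ, twU K b ρ x * twV K b ρ y * twW K b ρ z).coeff j =
      if j = 3 then twTensor K b x y z else 0 := by
  rw [TwIdx.sum_univ]
  cases x <;> cases y <;> cases z <;> interval_cases j <;>
    simp [twTensor, twMul, twU, twV, twW, Polynomial.coeff_monomial, Polynomial.coeff_one,
      Polynomial.monomial_mul_monomial, coeff_ite, Finset.sum_ite_eq, ite_mul, mul_ite, mul_sub]

/-- An enumeration of the `2b + 3` triads by `Fin (2b + 3)` (`card (TwIdx b) = b + b + 3`). [folklore] -/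
noncomputable def triadEquiv : Fin (b + b + 3) ≃ TwIdx b :=
  (Fintype.equivFinOfCardEq TwIdx.card).symm

/-- **`TW_b` has an order-`3` approximate decomposition with `2b + 3` triads** over `K[ε]`, for every
commutative ring `K` (Bläser 2013, Def. 6.1: `IsApproxDecomposition`). [folklore] -/
theorem isApproxDecomposition_twTensor :
    IsApproxDecomposition 3 (twTensor K b) (fun ρ => twU K b (triadEquiv b ρ))
      (fun ρ => twV K b (triadEquiv b ρ)) (fun ρ => twW K b (triadEquiv b ρ)) := by
  intro x y z j hj
  have hs : (∑ ρ : Fin (b + b + 3), twU K b (triadEquiv b ρ) x * twV K b (triadEquiv b ρ) y *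
      twW K b (triadEquiv b ρ) z) = ∑ σ, twU K b σ x * twV K b σ y * twW K b σ z :=
    (triadEquiv b).sum_comp (fun σ => twU K b σ x * twV K b σ y * twW K b σ z)
  rw [hs]
  exact twIdentity K b x y z j hj

/-- **`R_3(TW_b) ≤ 2b + 3`** (order-`3` approximate rank). [folklore] -/
theorem approxRank_three_twTensor_le : approxRank 3 (twTensor K b) ≤ b + b + 3 :=
  approxRank_le_of_isApproxDecomposition (isApproxDecomposition_twTensor K b)

/-- **`bR(TW_b) ≤ 2b + 3 = dim TW_b`**: the structure tensor of the twin algebra `CW_b ×_K CW_b` has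
minimal border rank (over `K[ε]`, every commutative ring `K`). [folklore] -/
theorem algBorderRank_twTensor_le : algBorderRank (twTensor K b) ≤ b + b + 3 :=
  (algBorderRank_le_approxRank 3 _).trans (approxRank_three_twTensor_le K b)

/-- **`R̃(TW_b) ≤ 2b + 3`** (asymptotic rank, `R̃ ≤ bR`). [folklore] -/
theorem asymptoticRank_twTensor_le : asymptoticRank (twTensor K b) ≤ (b : ℝ) + b + 3 := by
  have h := asymptoticRank_le_of_algBorderRank_le (algBorderRank_twTensor_le K b)
  exact_mod_cast h

end Decomposition

end Summit.MatrixMultiplication.MatrixMultiplication.Theorems.SaturationLadderTwinCW
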